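import Summits.BirchSwinnertonDyer.BirchSwinnertonDyer.Theorems.AdditiveKolyvaginRoadRamifiedHabitatSignLawIZeroStar
import HarnessLib

/-!
# Route `AdditiveKolyvaginRoad`, crux KS′ `LevelKolyvaginSystemsAdditive` (stmt-BirchSwinnertonDyer-21396), card `ramified-toric-habitat` —
# part 9: the sign law READ ON A GLOBAL MINIMAL MODEL (`ord_p Δ_min`, `p ∣ c₄`) — headline forms

Cell `pub/bsd-wall`, width seat `bsd-wall-akr-p2x-w2` g11; `--supports stmt-BirchSwinnertonDyer-21396` (helper). THEOREMS ONLY; no definition,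
no named fact, no `sorry`. BSD is not proved by any of this; KS′/KPA′ stay OPEN at `p² ∣ N`.

Parts 1–8 phrase the local hypotheses at `p` by the chosen `ℤ_p`-minimal model (`addVal` of its integral model), exactly as Rohrlich's
`localRootNumber`. Here they are read on the tree's global data of a GLOBALLY MINIMAL `W/ℚ` (`IsGloballyMinimal`; `W.minimalDiscriminantInt`,
`W.integralModelInt`): `W/ℚ_p` is itself `ℤ_p`-minimal (`isMinimal_map_padic_of_isGloballyMinimal`) and `ord Δ`, `ord c₄` do not depend on the
minimal model (Silverman *AEC* VII.1 Prop. 1.3(b)).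

* `addVal_padicInt_intCast`, `addVal_minimal_padic_of_isGloballyMinimal`, `localHypotheses_of_isGloballyMinimal` — the bridge:
  `ord_p Δ(chosen model) = padicValInt p Δ_min(W)`, `ord_p c₄(chosen model) = ord_p c₄(W_ℤ)`; `p ∣ c₄(W_ℤ)` ⟹ additive; «`c₄ = 0` or
  `ord_p Δ_min ≤ 3 ord_p c₄`» ⟹ potentially good.
* `signLaw_supercuspidal_of_isGloballyMinimal` — **the card's `SignLawSupercuspidal` in tree currency**: `N = M p²` (`p ≥ 5`, `M` squarefree),
  `ord_p Δ_min ∈ {2,3,4,8,9,10}`, `p ∣ c₄`, potentially good, `e := 12/gcd(12, ord_p Δ_min) ∤ p − 1`; `K′` imaginary quadratic, `d_{K′}` odd,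
  `p ∣ d_{K′}`, every `q ∣ M` split ⟹ `w(E)·w(E^{(d_{K′})}) = +1`. Conditional on {`exists_isNewformOf`, `atkinLehnerEigenvalueAt_eq_localRootNumberAt`
  for `W` and `W^{(p*)}`}.
* `signLaw_principalSeries_of_isGloballyMinimal` (`e ∈ {3,4,6}`, `e ∣ p − 1 ⟹ −1`, same conditions) and `signLaw_IZeroStar_of_isGloballyMinimal`
  (`ord_p Δ_min = 6 ⟹ −1`, assuming ONLY `exists_isNewformOf`).

References: [cite: SilvermanAEC2009, VII.1 Prop. 1.3(b) and VIII.8] [cite: Rohrlich1993Compositio, Prop. 2(iv)] [cite: KellockDokchitser2023, Rem. 2.2]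
[cite: MurtyMurty1997, Ch. 6 §1].
-/

set_option autoImplicit false
set_option linter.dupNamespace false

noncomputable section

open scoped Classical MatrixGroups

open CongruenceSubgroup IsDedekindDomain IsDedekindDomain.HeightOneSpectrum NumberField Rat.HeightOneSpectrum
  WeierstrassCurve Literature.NumberTheory.EllipticCurves Literature.NumberTheory.EllipticCurves.ModularForms
  IsDiscreteValuationRing

namespace Summit.BirchSwinnertonDyer.BirchSwinnertonDyer.Theorems.AdditiveKoly.RamifiedHabitat

/-! ## §10 Reading the hypotheses on a GLOBAL MINIMAL MODEL: `ord_p Δ_min` and `ord_p c₄` of `W.integralModelInt` -/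

section GlobalMinimal

open scoped NumberTheorySymbols

variable {p : ℕ} [Fact p.Prime]

/-- On `ℤ_p`: the additive valuation of a nonzero integer `n` is `padicValInt p n` (`x = u·p^{v}`, Mathlib's `PadicInt.unitCoeff_spec`,
`Padic.valuation_intCast`). [folklore] -/
theorem addVal_padicInt_intCast {n : ℤ} (hn : n ≠ 0) : addVal ℤ_[p] (n : ℤ_[p]) = (padicValInt p n : ℕ) := by
  have hx : (n : ℤ_[p]) ≠ 0 := by exact_mod_cast hn
  have h := addVal_def (n : ℤ_[p]) (PadicInt.unitCoeff hx) PadicInt.irreducible_p ((n : ℤ_[p])).valuation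
    (PadicInt.unitCoeff_spec hx)
  rw [h]
  congr 1
  have h2 : (((n : ℤ_[p])).valuation : ℤ) = padicValInt p n := by
    rw [← PadicInt.valuation_coe, PadicInt.coe_intCast, Padic.valuation_intCast]
  exact_mod_cast h2

/-- **For a GLOBALLY MINIMAL `W/ℚ`, the chosen `ℤ_p`-minimal model has `ord_p Δ = ord_p Δ_min(W)` and `ord_p c₄ = ord_p c₄(W_ℤ)`** (`W_ℤ =
W.integralModelInt`; `W/ℚ_p` is itself `ℤ_p`-minimal, `isMinimal_map_padic_of_isGloballyMinimal`, and `ord Δ`, `ord c₄` do not depend on the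
minimal model, Silverman *AEC* VII.1 Prop. 1.3(b)). The second value is `⊤` when `c₄ = 0`. [cite: SilvermanAEC2009, VII.1 Prop. 1.3(b) and VIII.8] -/
theorem addVal_minimal_padic_of_isGloballyMinimal (W : WeierstrassCurve ℚ) [W.IsElliptic] [W.IsGloballyMinimal] :
    addVal ℤ_[p] (((W.baseChange ℚ_[p]).minimal ℤ_[p]).integralModel ℤ_[p]).Δ = (padicValInt p W.minimalDiscriminantInt : ℕ) ∧
      addVal ℤ_[p] (((W.baseChange ℚ_[p]).minimal ℤ_[p]).integralModel ℤ_[p]).c₄ = addVal ℤ_[p] (W.integralModelInt.c₄ : ℤ_[p]) := by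
  set Wp := W.baseChange ℚ_[p] with hWp
  haveI : Wp.IsElliptic := by rw [hWp]; change (W.map _).IsElliptic; infer_instance
  haveI hmin : Wp.IsMinimal ℤ_[p] := isMinimal_map_padic_of_isGloballyMinimal W p
  obtain ⟨C, hC⟩ : ∃ C : VariableChange ℚ_[p], Wp.minimal ℤ_[p] = C • Wp := ⟨_, rfl⟩
  have hWint : (W.integralModelInt).map (Int.castRingHom ℚ) = W := W.map_integralModelInt
  have hΔ : (Wp.integralModel ℤ_[p]).Δ = (W.minimalDiscriminantInt : ℤ_[p]) := by
    apply IsFractionRing.injective ℤ_[p] ℚ_[p]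
    rw [integralModel_Δ_eq, hWp]
    change (W.map (algebraMap ℚ ℚ_[p])).Δ = _
    rw [map_Δ, ← cast_minimalDiscriminantInt, map_intCast]
    simp
  have hc₄ : (Wp.integralModel ℤ_[p]).c₄ = (W.integralModelInt.c₄ : ℤ_[p]) := by
    apply IsFractionRing.injective ℤ_[p] ℚ_[p]
    rw [integralModel_c₄_eq, hWp]
    change (W.map (algebraMap ℚ ℚ_[p])).c₄ = _
    rw [map_c₄]
    conv_lhs => rw [← hWint, map_c₄]
    simp
  refine ⟨?_, ?_⟩
  · rw [addVal_Δ_integralModel_eq_of_isMinimal_of_eq_smul ℤ_[p] hC, hΔ,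
      addVal_padicInt_intCast (W.minimalDiscriminantInt_ne_zero)]
  · rw [addVal_c₄_integralModel_eq_of_isMinimal_of_eq_smul ℤ_[p] hC Wp.isUnit_Δ.ne_zero, hc₄]

/-- The local hypotheses of this series read on a global minimal model: with `a := ord_p Δ_min(W)` and `c₄ := c₄(W_ℤ)`,
`p ∣ c₄` gives `ord_p c₄ ≠ 0`, and «`c₄ = 0` or `a ≤ 3·ord_p c₄`» gives `¬ 3 ord_p c₄ < ord_p Δ` (potentially good). [folklore] -/
theorem localHypotheses_of_isGloballyMinimal (W : WeierstrassCurve ℚ) [W.IsElliptic] [W.IsGloballyMinimal]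
    (hpc₄ : (p : ℤ) ∣ W.integralModelInt.c₄)
    (hj : W.integralModelInt.c₄ = 0 ∨ padicValInt p W.minimalDiscriminantInt ≤ 3 * padicValInt p W.integralModelInt.c₄) :
    addVal ℤ_[p] (((W.baseChange ℚ_[p]).minimal ℤ_[p]).integralModel ℤ_[p]).Δ = (padicValInt p W.minimalDiscriminantInt : ℕ) ∧
      addVal ℤ_[p] (((W.baseChange ℚ_[p]).minimal ℤ_[p]).integralModel ℤ_[p]).c₄ ≠ 0 ∧
      ¬ 3 * addVal ℤ_[p] (((W.baseChange ℚ_[p]).minimal ℤ_[p]).integralModel ℤ_[p]).c₄ <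
        addVal ℤ_[p] (((W.baseChange ℚ_[p]).minimal ℤ_[p]).integralModel ℤ_[p]).Δ := by
  obtain ⟨hΔ, hc₄⟩ := addVal_minimal_padic_of_isGloballyMinimal (p := p) W
  refine ⟨hΔ, ?_, ?_⟩
  · rw [hc₄]
    by_cases h0 : W.integralModelInt.c₄ = 0
    · rw [h0, Int.cast_zero, IsDiscreteValuationRing.addVal_zero]; exact ENat.top_ne_zero
    · rw [addVal_padicInt_intCast h0]
      have hp : p.Prime := Fact.out
      have : padicValInt p W.integralModelInt.c₄ ≠ 0 := by
        rw [ne_eq, padicValInt.eq_zero_iff]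
        push Not
        exact ⟨hp.ne_one, h0, hpc₄⟩
      exact_mod_cast this
  · rw [hc₄, hΔ]
    by_cases h0 : W.integralModelInt.c₄ = 0
    · rw [h0, Int.cast_zero, IsDiscreteValuationRing.addVal_zero]; simp
    · rw [addVal_padicInt_intCast h0]
      have h1 := hj.resolve_left h0
      intro hlt
      have h2 : ((3 * padicValInt p W.integralModelInt.c₄ : ℕ) : ℕ∞) < (padicValInt p W.minimalDiscriminantInt : ℕ∞) := by
        push_cast; exact hlt
      have h3 : 3 * padicValInt p W.integralModelInt.c₄ < padicValInt p W.minimalDiscriminantInt := by exact_mod_cast h2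
      omega

end GlobalMinimal


/-! ## §11 Headline forms on a global minimal model -/

section Headline

open scoped NumberTheorySymbols

variable {p : ℕ} [Fact p.Prime]

/-- **RAMIFIED-HABITAT SIGN LAW, SUPERCUSPIDAL HALF, on a global minimal model.** `W/ℚ` a GLOBAL MINIMAL model of an elliptic curve with
`N = M·p²` (`p ≥ 5`, `M` squarefree, `p ∤ M`); at `p`: `a := ord_p Δ_min ∈ {2,3,4,8,9,10}` (Kodaira II, III, IV, IV*, III*, II*), `p ∣ c₄(W_ℤ)`,
and `c₄ = 0` or `a ≤ 3·ord_p c₄` (potentially good); `e := 12/gcd(12, a)`. `K′` imaginary quadratic with `d_{K′}` odd, `p ∣ d_{K′}`, every prime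
`q ∣ M` split in `K′`. If `e ∤ p − 1` then `w(E)·w(E^{(d_{K′})}) = +1`. CONDITIONAL on the Modularity Theorem and Kellock–Dokchitser's Rem. 2.2
at `p` for `W`, `W^{(p*)}`; BSD is not proved by this. [cite: Rohrlich1993Compositio, Prop. 2(iv)] [cite: KellockDokchitser2023, Rem. 2.2] -/
theorem signLaw_supercuspidal_of_isGloballyMinimal (W : WeierstrassCurve ℚ) [W.IsElliptic] [W.IsGloballyMinimal]
    (hmod : exists_isNewformOf) (hF1 : W.atkinLehnerEigenvalueAt_eq_localRootNumberAt)
    (hF1' : (W.quadraticTwist (((-1 : ℤ) ^ (p / 2) * p : ℤ) : ℚ)).atkinLehnerEigenvalueAt_eq_localRootNumberAt)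
    (hp5 : 5 ≤ p) {M : ℕ} (hN : W.conductorNorm ℤ = M * p ^ 2) (hM : Squarefree M) (hpM : ¬ p ∣ M) {a : ℕ}
    (hΔ : padicValInt p W.minimalDiscriminantInt = a) (ha : a = 2 ∨ a = 3 ∨ a = 4 ∨ a = 8 ∨ a = 9 ∨ a = 10)
    (hpc₄ : (p : ℤ) ∣ W.integralModelInt.c₄)
    (hj : W.integralModelInt.c₄ = 0 ∨ padicValInt p W.minimalDiscriminantInt ≤ 3 * padicValInt p W.integralModelInt.c₄)
    (K : Type) [Field K] [NumberField K] (hK : IsImaginaryQuadratic K) (hKodd : Odd (NumberField.discr K))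
    (hpd : (p : ℤ) ∣ NumberField.discr K)
    (hodd : ∀ q ∈ M.primeFactors, q ≠ 2 → J(NumberField.discr K | q) = 1)
    (htwo : 2 ∣ M → NumberField.discr K % 8 = 1)
    (hsc : ¬ 12 / Nat.gcd a 12 ∣ p - 1) :
    W.rootNumber * (W.quadraticTwist (NumberField.discr K : ℚ)).rootNumber = 1 := by
  obtain ⟨hΔ', hc₄', hj'⟩ := localHypotheses_of_isGloballyMinimal (p := p) W hpc₄ hj
  rw [hΔ] at hΔ'
  rcases ha with h | h | h | h | h | h
  · exact rootNumber_mul_rootNumber_twist_discr_eq_one_of_not_dvd W hmod hF1 hF1' hp5 hN hM hpM hΔ' (Or.inl h) hc₄' hj' K hK hKodd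
      hpd hodd htwo hsc
  · exact rootNumber_mul_rootNumber_twist_discr_eq_one_of_not_dvd W hmod hF1 hF1' hp5 hN hM hpM hΔ' (Or.inr (Or.inl h)) hc₄' hj' K hK
      hKodd hpd hodd htwo hsc
  · exact rootNumber_mul_rootNumber_twist_discr_eq_one_of_not_dvd W hmod hF1 hF1' hp5 hN hM hpM hΔ' (Or.inr (Or.inr h)) hc₄' hj' K hK
      hKodd hpd hodd htwo hsc
  · exact rootNumber_mul_rootNumber_twist_discr_of_ge_eq_one_of_not_dvd W hmod hF1 hF1' hp5 hN hM hpM hΔ' (Or.inl h) hc₄' hj' K hK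
      hKodd hpd hodd htwo hsc
  · exact rootNumber_mul_rootNumber_twist_discr_of_ge_eq_one_of_not_dvd W hmod hF1 hF1' hp5 hN hM hpM hΔ' (Or.inr (Or.inl h)) hc₄' hj'
      K hK hKodd hpd hodd htwo hsc
  · exact rootNumber_mul_rootNumber_twist_discr_of_ge_eq_one_of_not_dvd W hmod hF1 hF1' hp5 hN hM hpM hΔ' (Or.inr (Or.inr h)) hc₄' hj'
      K hK hKodd hpd hodd htwo hsc

/-- **RAMIFIED-HABITAT SIGN LAW, PRINCIPAL-SERIES HALF (`e ∈ {3,4,6}`, `e ∣ p − 1`), on a global minimal model**: same data,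
`w(E)·w(E^{(d_{K′})}) = −1`. Conditional on {hmod, F1 at `p`}. [cite: Rohrlich1993Compositio, Prop. 2(iv)] [cite: KellockDokchitser2023, Rem. 2.2] -/
theorem signLaw_principalSeries_of_isGloballyMinimal (W : WeierstrassCurve ℚ) [W.IsElliptic] [W.IsGloballyMinimal]
    (hmod : exists_isNewformOf) (hF1 : W.atkinLehnerEigenvalueAt_eq_localRootNumberAt)
    (hF1' : (W.quadraticTwist (((-1 : ℤ) ^ (p / 2) * p : ℤ) : ℚ)).atkinLehnerEigenvalueAt_eq_localRootNumberAt)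
    (hp5 : 5 ≤ p) {M : ℕ} (hN : W.conductorNorm ℤ = M * p ^ 2) (hM : Squarefree M) (hpM : ¬ p ∣ M) {a : ℕ}
    (hΔ : padicValInt p W.minimalDiscriminantInt = a) (ha : a = 2 ∨ a = 3 ∨ a = 4 ∨ a = 8 ∨ a = 9 ∨ a = 10)
    (hpc₄ : (p : ℤ) ∣ W.integralModelInt.c₄)
    (hj : W.integralModelInt.c₄ = 0 ∨ padicValInt p W.minimalDiscriminantInt ≤ 3 * padicValInt p W.integralModelInt.c₄)
    (K : Type) [Field K] [NumberField K] (hK : IsImaginaryQuadratic K) (hKodd : Odd (NumberField.discr K))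
    (hpd : (p : ℤ) ∣ NumberField.discr K)
    (hodd : ∀ q ∈ M.primeFactors, q ≠ 2 → J(NumberField.discr K | q) = 1)
    (htwo : 2 ∣ M → NumberField.discr K % 8 = 1)
    (hps : 12 / Nat.gcd a 12 ∣ p - 1) :
    W.rootNumber * (W.quadraticTwist (NumberField.discr K : ℚ)).rootNumber = -1 := by
  obtain ⟨hΔ', hc₄', hj'⟩ := localHypotheses_of_isGloballyMinimal (p := p) W hpc₄ hj
  rw [hΔ] at hΔ'
  rcases ha with h | h | h | h | h | h
  · exact rootNumber_mul_rootNumber_twist_discr_eq_neg_one_of_dvd W hmod hF1 hF1' hp5 hN hM hpM hΔ' (Or.inl h) hc₄' hj' K hK hKodd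
      hpd hodd htwo hps
  · exact rootNumber_mul_rootNumber_twist_discr_eq_neg_one_of_dvd W hmod hF1 hF1' hp5 hN hM hpM hΔ' (Or.inr (Or.inl h)) hc₄' hj' K hK
      hKodd hpd hodd htwo hps
  · exact rootNumber_mul_rootNumber_twist_discr_eq_neg_one_of_dvd W hmod hF1 hF1' hp5 hN hM hpM hΔ' (Or.inr (Or.inr h)) hc₄' hj' K hK
      hKodd hpd hodd htwo hps
  · exact rootNumber_mul_rootNumber_twist_discr_of_ge_eq_neg_one_of_dvd W hmod hF1 hF1' hp5 hN hM hpM hΔ' (Or.inl h) hc₄' hj' K hK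
      hKodd hpd hodd htwo hps
  · exact rootNumber_mul_rootNumber_twist_discr_of_ge_eq_neg_one_of_dvd W hmod hF1 hF1' hp5 hN hM hpM hΔ' (Or.inr (Or.inl h)) hc₄'
      hj' K hK hKodd hpd hodd htwo hps
  · exact rootNumber_mul_rootNumber_twist_discr_of_ge_eq_neg_one_of_dvd W hmod hF1 hF1' hp5 hN hM hpM hΔ' (Or.inr (Or.inr h)) hc₄'
      hj' K hK hKodd hpd hodd htwo hps

/-- **TYPE I₀* on a global minimal model: `w(E)·w(E^{(d_{K′})}) = −1`, assuming only the Modularity Theorem** (`ord_p Δ_min = 6`, `p ∣ c₄(W_ℤ)`,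
`c₄ = 0` or `6 ≤ 3 ord_p c₄`; habitat as above). BSD is not proved by this. [cite: Rohrlich1993Compositio, Prop. 2(iv)] [cite: KellockDokchitser2023, Rem. 2.2] -/
theorem signLaw_IZeroStar_of_isGloballyMinimal (W : WeierstrassCurve ℚ) [W.IsElliptic] [W.IsGloballyMinimal]
    (hmod : exists_isNewformOf) (hp5 : 5 ≤ p) {M : ℕ} (hN : W.conductorNorm ℤ = M * p ^ 2) (hM : Squarefree M) (hpM : ¬ p ∣ M)
    (hΔ : padicValInt p W.minimalDiscriminantInt = 6) (hpc₄ : (p : ℤ) ∣ W.integralModelInt.c₄)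
    (hj : W.integralModelInt.c₄ = 0 ∨ padicValInt p W.minimalDiscriminantInt ≤ 3 * padicValInt p W.integralModelInt.c₄)
    (K : Type) [Field K] [NumberField K] (hK : IsImaginaryQuadratic K) (hKodd : Odd (NumberField.discr K))
    (hpd : (p : ℤ) ∣ NumberField.discr K)
    (hodd : ∀ q ∈ M.primeFactors, q ≠ 2 → J(NumberField.discr K | q) = 1)
    (htwo : 2 ∣ M → NumberField.discr K % 8 = 1) :
    W.rootNumber * (W.quadraticTwist (NumberField.discr K : ℚ)).rootNumber = -1 := by
  obtain ⟨hΔ', hc₄', hj'⟩ := localHypotheses_of_isGloballyMinimal (p := p) W hpc₄ hj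
  rw [hΔ] at hΔ'
  obtain ⟨d', hd, hd'4, hd'sq, hgcd, hneg⟩ := ramifiedHabitat_data_of_discr (by omega) hM K hK hKodd hpd hodd htwo
  rw [hd] at hodd htwo ⊢
  rw [← hN] at hgcd
  exact rootNumber_mul_rootNumber_ramifiedTwist_of_six W hmod hp5 hN hM hpM hΔ' hc₄' hj' hd'4 hd'sq hgcd hneg hodd htwo

end Headline

end Summit.BirchSwinnertonDyer.BirchSwinnertonDyer.Theorems.AdditiveKoly.RamifiedHabitat

end
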